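import Summits.BirchSwinnertonDyer.BirchSwinnertonDyer.Theorems.Rank2Observatory2DescCoordCert
import Summits.BirchSwinnertonDyer.BirchSwinnertonDyer.Theorems.Rank2Observatory2DescRowCert
import Summits.BirchSwinnertonDyer.BirchSwinnertonDyer.Theorems.Rank2Observatory2DescClValuation
import Summits.BirchSwinnertonDyer.BirchSwinnertonDyer.Theorems.Rank2Observatory2DescClGlue
import Summits.BirchSwinnertonDyer.BirchSwinnertonDyer.Theorems.Rank2Observatory2DescClIndexCert
import Summits.BirchSwinnertonDyer.BirchSwinnertonDyer.Theorems.Rank2Observatory2DescCertificates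
import HarnessLib

/-!
# BirchSwinnertonDyer — rank ≥ 2 observatory: KERNEL-2DESC-CL v2.0 — coordinate certificates for ideals, units and characters

HONEST FRAMING: per-curve certified theorems and census instruments; no claim on BSD in rank ≥ 2.

First generic file of the REFLECTIVE reshape (v2.0) of the class-group-general kernel 2-descent
(KERNEL-2DESC-CL, cell `b2b-bsdr2`, seat cert-1; design `b2b-bsdr2-cert-1/KERNEL-2DESC-CL.md` §7, following
gate4's CERT-LANE RULING: ONE Boolean checker over a per-field record and one over a per-curve record, ONE
soundness theorem each).  Everything a v1 per-field / per-curve file proved by a bespoke `ring` /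
`linear_combination` / `norm_num` step is replaced here by a COMPUTABLE check on integer coordinate triples
`(x₀, x₁, x₂) ↦ x₀ + x₁α + x₂α²` (cert-3's `TwoDescCubic.lin`, `MonicCubic.mulCoords`, p338697) and a soundness
lemma proved once:

* `TwoDescCl.idealOf hα (p, G)` — the ideal `(p, G(α))` of `𝓞 K` presented by a prime-ideal CODE `(p, g₀, g₁, g₂)`
  (degree one: `G = α + g₀`; degree two: `G = α² + g₁α + g₀`; inert: `G = 0`, the ideal `(p)`);
* `TwoDescCl.memCode`, `lin_mem_idealOf_of_memCode` — MEMBERSHIP `x(α) ∈ (p, G(α))` from coordinate congruences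
  (`p ∣ x(−g₀)`; `p ∣` the remainder of `x` by `G`; `p ∣` every coordinate);
* `TwoDescCl.invCert`, `lin_not_mem_of_invCert` — NON-MEMBERSHIP from an inverse triple `y`: `x·y − 1 ∈ (p, G(α))`;
* `TwoDescCl.norm_lin_coords`, `lin_ne_zero_of_coords` — the norm of `x(α)` is `normFormZ` of its coordinates;
* `TwoDescCl.valuation_eq_one_of_unitCert`, `log_valuation_eq_zero_of_unitCert` — units from `mulCoords u v = 1`;
* `TwoDescCl.sign_iff_of_signCond` — the real sign bit from cert-3's interval test `signCond` (p339409);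
* `TwoDescCl.ringHom_lin_eq`, `eulerBit`, `eulerBit_iff_legendreSym` — residue characters `ψ_{ℓ,t}` on coordinates
  and the Legendre parity bit by EULER'S CRITERION (`v^{(ℓ−1)/2} ≡ −1`), so that no `legendreSym` is evaluated
  in the kernel; `even_card_filter_eulerBit` — the parity row it yields for a square sub-product.

Sorry-free; axioms `propext`, `Classical.choice`, `Quot.sound`.
[cite: Cohen1993, §4.8.2 (prime ideals `(p, T(α))`), §1.4.2 (Euler's criterion)] [cite: Marcus2018, Ch. 3, Thm. 27]
-/

set_option linter.dupNamespace false

noncomputable section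

open scoped Classical NumberField nonZeroDivisors

open Literature.NumberTheory.NumberFields Polynomial Module NumberField IsDedekindDomain Ideal

namespace Summit.BirchSwinnertonDyer.BirchSwinnertonDyer.Rank2Observatory.TwoDescCl

open TwoDescCubic

/-! ## Prime-ideal codes and membership certificates -/

/-- A prime-ideal CODE `(p, g₀, g₁, g₂)`: the ideal `(p, g₀ + g₁α + g₂α²)` of `𝓞 K`. [cite: Cohen1993, §4.8.2] -/
abbrev PCode : Type := ℕ × ℤ × ℤ × ℤ

variable {K : Type*} [Field K] [NumberField K] {a b c : ℤ} {θ : K}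

omit [NumberField K] in
/-- The ideal `(p, G(α))` presented by a code. [cite: Cohen1993, §4.8.2] -/
def idealOf (hθ : aeval θ (MonicCubic.poly a b c) = 0) (P : PCode) : Ideal (𝓞 K) :=
  span {(P.1 : 𝓞 K), lin hθ P.2.1 P.2.2.1 P.2.2.2}

/-- **Membership test** `x(α) ∈ (p, G(α))` on coordinates: degree two (`g₂ = 1`): `p` divides the two
coordinates of the remainder of `x` by `G`; degree one (`g₁ = 1`, `g₂ = 0`, root `r = −g₀`): `p ∣ x(r)`;
otherwise (inert, `G = 0`): `p` divides every coordinate.  Computable. [cite: Cohen1993, §4.8.2] -/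
def memCode (P : PCode) (x : ℤ × ℤ × ℤ) : Bool :=
  if P.2.2.2 = 1 then
    decide ((P.1 : ℤ) ∣ x.2.1 - x.2.2 * P.2.2.1) && decide ((P.1 : ℤ) ∣ x.1 - x.2.2 * P.2.1)
  else if P.2.2.1 = 1 ∧ P.2.2.2 = 0 then
    decide ((P.1 : ℤ) ∣ x.1 - x.2.1 * P.2.1 + x.2.2 * P.2.1 * P.2.1)
  else
    decide ((P.1 : ℤ) ∣ x.1) && decide ((P.1 : ℤ) ∣ x.2.1) && decide ((P.1 : ℤ) ∣ x.2.2)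

omit [NumberField K] in
/-- **Soundness of the membership test.** [cite: Cohen1993, §4.8.2] -/
theorem lin_mem_idealOf_of_memCode (hθ : aeval θ (MonicCubic.poly a b c) = 0) (P : PCode)
    (x : ℤ × ℤ × ℤ) (h : memCode P x = true) : lin hθ x.1 x.2.1 x.2.2 ∈ idealOf hθ P := by
  obtain ⟨p, g₀, g₁, g₂⟩ := P
  obtain ⟨x₀, x₁, x₂⟩ := x
  unfold memCode at h
  simp only [idealOf]
  split_ifs at h with h2 h1
  · -- degree two: `G = g₀ + g₁α + α²`
    simp only [Bool.and_eq_true, decide_eq_true_eq] at h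
    obtain ⟨⟨k₁, hk₁⟩, ⟨k₀, hk₀⟩⟩ := h
    subst h2
    refine Ideal.mem_span_pair.mpr ⟨lin hθ k₀ k₁ 0, (x₂ : 𝓞 K), ?_⟩
    have e₁ : ((x₁ : ℤ) : 𝓞 K) - x₂ * g₁ = (p : 𝓞 K) * k₁ := by exact_mod_cast congrArg (fun z : ℤ => (z : 𝓞 K)) hk₁
    have e₀ : ((x₀ : ℤ) : 𝓞 K) - x₂ * g₀ = (p : 𝓞 K) * k₀ := by exact_mod_cast congrArg (fun z : ℤ => (z : 𝓞 K)) hk₀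
    simp only [lin]
    push_cast
    linear_combination (-1 : 𝓞 K) * e₀ + (-(MonicCubic.thetaInt hθ)) * e₁
  · -- degree one: `G = α + g₀`, root `-g₀`
    simp only [decide_eq_true_eq] at h
    obtain ⟨k, hk⟩ := h
    obtain ⟨rfl, rfl⟩ := h1
    refine Ideal.mem_span_pair.mpr ⟨(k : 𝓞 K), lin hθ (x₁ - x₂ * g₀) x₂ 0, ?_⟩
    have e : ((x₀ : ℤ) : 𝓞 K) - x₁ * g₀ + x₂ * g₀ * g₀ = (p : 𝓞 K) * k := by
      exact_mod_cast congrArg (fun z : ℤ => (z : 𝓞 K)) hk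
    simp only [lin]
    push_cast
    linear_combination (-1 : 𝓞 K) * e
  · -- inert (or any other code): `p` divides every coordinate
    simp only [Bool.and_eq_true, decide_eq_true_eq] at h
    obtain ⟨⟨⟨k₀, hk₀⟩, ⟨k₁, hk₁⟩⟩, ⟨k₂, hk₂⟩⟩ := h
    refine Ideal.mem_span_pair.mpr ⟨lin hθ k₀ k₁ k₂, 0, ?_⟩
    have e₀ : ((x₀ : ℤ) : 𝓞 K) = (p : 𝓞 K) * k₀ := by exact_mod_cast congrArg (fun z : ℤ => (z : 𝓞 K)) hk₀
    have e₁ : ((x₁ : ℤ) : 𝓞 K) = (p : 𝓞 K) * k₁ := by exact_mod_cast congrArg (fun z : ℤ => (z : 𝓞 K)) hk₁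
    have e₂ : ((x₂ : ℤ) : 𝓞 K) = (p : 𝓞 K) * k₂ := by exact_mod_cast congrArg (fun z : ℤ => (z : 𝓞 K)) hk₂
    simp only [lin]
    linear_combination (-1 : 𝓞 K) * e₀ + (-(MonicCubic.thetaInt hθ)) * e₁ +
      (-(MonicCubic.thetaInt hθ) ^ 2) * e₂

omit [NumberField K] in
/-- Membership of `x(α)` in a height-one prime presented by a code. [cite: Cohen1993, §4.8.2] -/
theorem lin_mem_of_memCode (hθ : aeval θ (MonicCubic.poly a b c) = 0) {P : PCode}
    (w : HeightOneSpectrum (𝓞 K)) (hw : w.asIdeal = idealOf hθ P) (x : ℤ × ℤ × ℤ) (h : memCode P x = true) :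
    lin hθ x.1 x.2.1 x.2.2 ∈ w.asIdeal := by
  rw [hw]; exact lin_mem_idealOf_of_memCode hθ P x h

/-! ## Products, inverses, non-membership -/

/-- `lin` is multiplicative on coordinates (`mulCoords`). [folklore] -/
theorem lin_mulCoords (hθ : aeval θ (MonicCubic.poly a b c) = 0) (u v : ℤ × ℤ × ℤ) :
    lin hθ (MonicCubic.mulCoords a b c u v).1 (MonicCubic.mulCoords a b c u v).2.1
        (MonicCubic.mulCoords a b c u v).2.2 = lin hθ u.1 u.2.1 u.2.2 * lin hθ v.1 v.2.1 v.2.2 := by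
  rw [lin_eq_evalCoords, lin_eq_evalCoords, lin_eq_evalCoords,
    MonicCubic.evalCoords_mulCoords (MonicCubic.thetaInt_rel hθ)]

/-- `x − 1` on coordinates. [folklore] -/
def subOne (u : ℤ × ℤ × ℤ) : ℤ × ℤ × ℤ := (u.1 - 1, u.2.1, u.2.2)

omit [NumberField K] in
/-- `lin (subOne u) = lin u − 1`. [folklore] -/
theorem lin_subOne (hθ : aeval θ (MonicCubic.poly a b c) = 0) (u : ℤ × ℤ × ℤ) :
    lin hθ (subOne u).1 (subOne u).2.1 (subOne u).2.2 = lin hθ u.1 u.2.1 u.2.2 - 1 := by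
  simp only [subOne, lin]; push_cast; ring

/-- **Inverse certificate** for NON-membership: `x·y − 1 ∈ (p, G(α))`. Computable. [folklore] -/
def invCert (a b c : ℤ) (P : PCode) (x y : ℤ × ℤ × ℤ) : Bool :=
  memCode P (subOne (MonicCubic.mulCoords a b c x y))

/-- Soundness of the inverse certificate for a proper ideal. [folklore] -/
theorem lin_not_mem_idealOf_of_invCert (hθ : aeval θ (MonicCubic.poly a b c) = 0) {P : PCode}
    (hP : idealOf hθ P ≠ ⊤) {x y : ℤ × ℤ × ℤ} (h : invCert a b c P x y = true) :
    lin hθ x.1 x.2.1 x.2.2 ∉ idealOf hθ P := by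
  intro hx
  have h1 := lin_mem_idealOf_of_memCode hθ P _ h
  rw [lin_subOne, lin_mulCoords] at h1
  apply hP
  rw [Ideal.eq_top_iff_one]
  have h2 := sub_mem (Ideal.mul_mem_right (lin hθ y.1 y.2.1 y.2.2) _ hx) h1
  rwa [sub_sub_cancel] at h2

/-- Soundness of the inverse certificate at a height-one prime presented by a code. [folklore] -/
theorem lin_not_mem_of_invCert (hθ : aeval θ (MonicCubic.poly a b c) = 0) {P : PCode}
    (w : HeightOneSpectrum (𝓞 K)) (hw : w.asIdeal = idealOf hθ P) {x y : ℤ × ℤ × ℤ}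
    (h : invCert a b c P x y = true) : lin hθ x.1 x.2.1 x.2.2 ∉ w.asIdeal := by
  rw [hw]
  exact lin_not_mem_idealOf_of_invCert hθ (hw ▸ w.isPrime.ne_top) h

/-- `v_w(x) = 1` from an inverse certificate at `w`. [folklore] -/
theorem valuation_eq_one_of_invCert (hθ : aeval θ (MonicCubic.poly a b c) = 0) {P : PCode}
    (w : HeightOneSpectrum (𝓞 K)) (hw : w.asIdeal = idealOf hθ P) {x y : ℤ × ℤ × ℤ}
    (h : invCert a b c P x y = true) : w.valuation K ((lin hθ x.1 x.2.1 x.2.2 : 𝓞 K) : K) = 1 :=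
  valuation_eq_one_of_not_mem w (lin_not_mem_of_invCert hθ w hw h)

/-- **A product certificate** `x · δ = m ^ k` on coordinates (the support of `x` lies above the primes of `m`).
Computable. [folklore] -/
def prodPowCert (a b c : ℤ) (x δ : ℤ × ℤ × ℤ) (m k : ℕ) : Bool :=
  decide (MonicCubic.mulCoords a b c x δ = powCoords a b c ((m : ℤ), 0, 0) k)

/-- Soundness of the product certificate: `x · δ = m ^ k` in `𝓞 K`. [folklore] -/
theorem mul_eq_pow_of_prodPowCert (hθ : aeval θ (MonicCubic.poly a b c) = 0) {x δ : ℤ × ℤ × ℤ} {m k : ℕ}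
    (h : prodPowCert a b c x δ m k = true) :
    lin hθ x.1 x.2.1 x.2.2 * lin hθ δ.1 δ.2.1 δ.2.2 = ((m : ℕ) : 𝓞 K) ^ k := by
  simp only [prodPowCert, decide_eq_true_eq] at h
  have e := congrArg (MonicCubic.evalCoords (MonicCubic.thetaInt hθ)) h
  rw [MonicCubic.evalCoords_mulCoords (MonicCubic.thetaInt_rel hθ),
    evalCoords_powCoords (MonicCubic.thetaInt_rel hθ), ← lin_eq_evalCoords, ← lin_eq_evalCoords,
    ← lin_eq_evalCoords] at e
  rw [e]
  simp [lin]

/-- From `x · δ = (p·q)^k`: every prime containing `x` contains `p` or `q`. [folklore] -/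
theorem natCast_mem_or_of_prodPowCert (hθ : aeval θ (MonicCubic.poly a b c) = 0) {x δ : ℤ × ℤ × ℤ}
    {p q k : ℕ} (h : prodPowCert a b c x δ (p * q) k = true) (v : HeightOneSpectrum (𝓞 K))
    (hx : lin hθ x.1 x.2.1 x.2.2 ∈ v.asIdeal) : (p : 𝓞 K) ∈ v.asIdeal ∨ (q : 𝓞 K) ∈ v.asIdeal :=
  natCast_mem_or_of_mul_eq_pow (mul_eq_pow_of_prodPowCert hθ h) v hx

/-! ## Norms and non-vanishing from coordinates -/

/-- **Norm on coordinates**: `N(x(α)) = normFormZ(x)`. [cite: Marcus2018, Ch. 2, Thm. 4] -/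
theorem norm_lin_coords (hirr : Irreducible (MonicCubic.polyQ a b c))
    (hθ : aeval θ (MonicCubic.poly a b c) = 0) (h3 : finrank ℚ K = 3) (x : ℤ × ℤ × ℤ) :
    Algebra.norm ℚ ((lin hθ x.1 x.2.1 x.2.2 : 𝓞 K) : K) = ((normFormZ a b c x.1 x.2.1 x.2.2 : ℤ) : ℚ) :=
  norm_lin_eq hirr hθ h3 _ _ _ (normForm_intCast a b c _ _ _)

/-- `|N(x(α))| = |normFormZ(x)|` in `ℕ`. [cite: Marcus2018, Ch. 2, Thm. 4] -/
theorem natAbs_norm_lin_coords (hirr : Irreducible (MonicCubic.polyQ a b c))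
    (hθ : aeval θ (MonicCubic.poly a b c) = 0) (h3 : finrank ℚ K = 3) (x : ℤ × ℤ × ℤ) :
    (Algebra.norm ℤ (lin hθ x.1 x.2.1 x.2.2)).natAbs = (normFormZ a b c x.1 x.2.1 x.2.2).natAbs :=
  natAbs_norm_lin hirr hθ h3 _ _ _ (normForm_intCast a b c _ _ _)

/-- `x(α) ≠ 0` when its norm form is non-zero. [folklore] -/
theorem lin_ne_zero_of_coords (hirr : Irreducible (MonicCubic.polyQ a b c))
    (hθ : aeval θ (MonicCubic.poly a b c) = 0) (h3 : finrank ℚ K = 3) (x : ℤ × ℤ × ℤ)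
    (h : normFormZ a b c x.1 x.2.1 x.2.2 ≠ 0) : lin hθ x.1 x.2.1 x.2.2 ≠ 0 := by
  intro h0
  have h1 := natAbs_norm_lin_coords hirr hθ h3 x
  rw [h0, Algebra.norm_zero, Int.natAbs_zero] at h1
  exact h (Int.natAbs_eq_zero.mp h1.symm)

/-! ## Units -/

/-- **Unit certificate**: `mulCoords u v = 1`. Computable. [folklore] -/
def unitCert (a b c : ℤ) (u v : ℤ × ℤ × ℤ) : Bool :=
  decide (MonicCubic.mulCoords a b c u v = (1, 0, 0))

/-- Soundness: `u(α)` is a unit. [folklore] -/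
theorem isUnit_of_unitCert (hθ : aeval θ (MonicCubic.poly a b c) = 0) {u v : ℤ × ℤ × ℤ}
    (h : unitCert a b c u v = true) : IsUnit (lin hθ u.1 u.2.1 u.2.2) :=
  isUnit_lin_of_coords hθ u v (by simpa [unitCert] using h)

/-- A unit lies in no height-one prime. [folklore] -/
theorem not_mem_of_unitCert (hθ : aeval θ (MonicCubic.poly a b c) = 0) {u v : ℤ × ℤ × ℤ}
    (h : unitCert a b c u v = true) (w : HeightOneSpectrum (𝓞 K)) : lin hθ u.1 u.2.1 u.2.2 ∉ w.asIdeal :=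
  fun hm => w.isPrime.ne_top (Ideal.eq_top_of_isUnit_mem _ hm (isUnit_of_unitCert hθ h))

/-- A certified unit has valuation `1` everywhere. [folklore] -/
theorem valuation_eq_one_of_unitCert (hθ : aeval θ (MonicCubic.poly a b c) = 0) {u v : ℤ × ℤ × ℤ}
    (h : unitCert a b c u v = true) (w : HeightOneSpectrum (𝓞 K)) :
    w.valuation K ((lin hθ u.1 u.2.1 u.2.2 : 𝓞 K) : K) = 1 :=
  valuation_eq_one_of_not_mem w (not_mem_of_unitCert hθ h w)

/-- A certified unit has additive valuation `0` everywhere. [folklore] -/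
theorem log_valuation_eq_zero_of_unitCert (hθ : aeval θ (MonicCubic.poly a b c) = 0) {u v : ℤ × ℤ × ℤ}
    (h : unitCert a b c u v = true) (w : HeightOneSpectrum (𝓞 K)) :
    WithZero.log (w.valuation K ((lin hθ u.1 u.2.1 u.2.2 : 𝓞 K) : K)) = 0 := by
  rw [valuation_eq_one_of_unitCert hθ h w, WithZero.log_one]

/-! ## The real sign bit -/

/-- **Sign bit from the interval test** (`true` = negative at the real place `ρ`, `lo < ρ(α) < hi`, `0 ≤ lo`).
[folklore] -/
theorem sign_iff_of_signCond (hθ : aeval θ (MonicCubic.poly a b c) = 0) (ρ : K →+* ℝ) {lo hi : ℚ}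
    (h0 : 0 ≤ lo) (hlo : ((lo : ℚ) : ℝ) < ρ θ) (hhi : ρ θ < ((hi : ℚ) : ℝ)) {g : ℤ × ℤ × ℤ} {sg : Bool}
    (h : signCond lo hi g sg = true) : (sg = true ↔ ρ ((lin hθ g.1 g.2.1 g.2.2 : 𝓞 K) : K) < 0) := by
  unfold signCond at h
  cases sg
  · simp only [Bool.false_eq_true, ↓reduceIte, decide_eq_true_eq] at h
    exact sg_false_iff_of_pos (lin_pos hθ ρ h0 hlo hhi _ _ _ h)
  · simp only [↓reduceIte, decide_eq_true_eq] at h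
    exact sg_true_iff_of_neg (lin_neg hθ ρ h0 hlo hhi _ _ _ h)

/-- A sign-certified element does not vanish at `ρ`. [folklore] -/
theorem rho_lin_ne_zero_of_signCond (hθ : aeval θ (MonicCubic.poly a b c) = 0) (ρ : K →+* ℝ) {lo hi : ℚ}
    (h0 : 0 ≤ lo) (hlo : ((lo : ℚ) : ℝ) < ρ θ) (hhi : ρ θ < ((hi : ℚ) : ℝ)) {g : ℤ × ℤ × ℤ} {sg : Bool}
    (h : signCond lo hi g sg = true) : ρ ((lin hθ g.1 g.2.1 g.2.2 : 𝓞 K) : K) ≠ 0 := by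
  unfold signCond at h
  cases sg
  · simp only [Bool.false_eq_true, ↓reduceIte, decide_eq_true_eq] at h
    exact (lin_pos hθ ρ h0 hlo hhi _ _ _ h).ne'
  · simp only [↓reduceIte, decide_eq_true_eq] at h
    exact (lin_neg hθ ρ h0 hlo hhi _ _ _ h).ne

/-! ## Residue characters `ψ_{ℓ,t}` and the Legendre bit by Euler's criterion -/

/-- `x(t) = x₀ + x₁t + x₂t²` in `ℤ`. [folklore] -/
def evalInt (t : ℤ) (x : ℤ × ℤ × ℤ) : ℤ := x.1 + x.2.1 * t + x.2.2 * t ^ 2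

omit [NumberField K] in
/-- A ring map `ψ` with `ψ(α) = t` sends `x(α)` to `x(t)`. [cite: Marcus2018, Ch. 3, Thm. 27] -/
theorem ringHom_lin_eq {S : Type*} [CommRing S] (hθ : aeval θ (MonicCubic.poly a b c) = 0)
    (ψ : 𝓞 K →+* S) {t : ℤ} (hψ : ψ (MonicCubic.thetaInt hθ) = (t : S)) (x : ℤ × ℤ × ℤ) :
    ψ (lin hθ x.1 x.2.1 x.2.2) = ((evalInt t x : ℤ) : S) := by
  simp only [lin, evalInt, map_add, map_mul, map_pow, map_intCast, hψ]
  push_cast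
  ring

/-- **Euler bit**: `v^{⌊ℓ/2⌋} ≡ −1 (mod ℓ)` (the Legendre symbol `(v/ℓ) = −1`, decided without `legendreSym`).
[cite: Cohen1993, §1.4.2] -/
def eulerBit (ℓ : ℕ) (v : ℤ) : Bool := decide (v ^ (ℓ / 2) % (ℓ : ℤ) = (ℓ : ℤ) - 1)

/-- `eulerBit ℓ v ↔ v^{⌊ℓ/2⌋} = −1` in `ℤ/ℓ`. [cite: Cohen1993, §1.4.2] -/
theorem eulerBit_iff_pow_eq_neg_one {ℓ : ℕ} (hℓ : 0 < ℓ) (v : ℤ) :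
    eulerBit ℓ v = true ↔ ((v : ℤ) : ZMod ℓ) ^ (ℓ / 2) = -1 := by
  haveI : NeZero ℓ := ⟨hℓ.ne'⟩
  have hneg : (-1 : ZMod ℓ) = (((ℓ : ℤ) - 1 : ℤ) : ZMod ℓ) := by
    push_cast
    rw [ZMod.natCast_self]
    ring
  have hmod : ((ℓ : ℤ) - 1) % (ℓ : ℤ) = (ℓ : ℤ) - 1 := Int.emod_eq_of_lt (by omega) (by omega)
  rw [eulerBit, decide_eq_true_eq, hneg, ← Int.cast_pow, ZMod.intCast_eq_intCast_iff', hmod]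

/-- **Euler's criterion as a bit**: for an odd prime `ℓ ∤ v`, `eulerBit ℓ v ↔ (v/ℓ) = −1`.
[cite: Cohen1993, §1.4.2] -/
theorem eulerBit_iff_legendreSym {ℓ : ℕ} [Fact ℓ.Prime] (hℓ : ℓ ≠ 2) {v : ℤ} (hv : ((v : ℤ) : ZMod ℓ) ≠ 0) :
    eulerBit ℓ v = true ↔ legendreSym ℓ v = -1 := by
  have hp : ℓ.Prime := Fact.out
  rw [eulerBit_iff_pow_eq_neg_one hp.pos, ← legendreSym.eq_pow ℓ v]
  rcases legendreSym.eq_one_or_neg_one ℓ hv with h1 | h1 <;> rw [h1]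
  · simp only [Int.cast_one]
    constructor
    · intro h
      exfalso
      have h2 : ((2 : ℕ) : ZMod ℓ) = 0 := by
        have e : (2 : ZMod ℓ) = 1 - (-1) := by ring
        rw [Nat.cast_ofNat, e, ← h, sub_self]
      rw [ZMod.natCast_eq_zero_iff] at h2
      exact hℓ ((Nat.prime_dvd_prime_iff_eq hp Nat.prime_two).mp h2)
    · intro h; norm_num at h
  · simp

/-- `ℓ ∤ v` on integers gives a non-zero residue. [folklore] -/
theorem intCast_zmod_ne_zero {ℓ : ℕ} {v : ℤ} (h : ¬ (ℓ : ℤ) ∣ v) : ((v : ℤ) : ZMod ℓ) ≠ 0 :=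
  fun h0 => h ((ZMod.intCast_zmod_eq_zero_iff_dvd v ℓ).mp h0)

omit [NumberField K] in
/-- **The Legendre parity row on coordinates**: for a residue map `ψ : 𝓞 K → ℤ/ℓ` with `ψ(α) = t`
(`ℓ` an odd prime) and a family `xᵢ(α)` with `ℓ ∤ xᵢ(t)`, a square sub-product has an even number of
indices flagged by `eulerBit ℓ (xᵢ(t))`. [cite: Cassels1991LecturesEllipticCurves, §15] -/
theorem even_card_filter_eulerBit {ι : Type*} (hθ : aeval θ (MonicCubic.poly a b c) = 0) {ℓ : ℕ}
    [Fact ℓ.Prime] (hℓ : ℓ ≠ 2) (ψ : 𝓞 K →+* ZMod ℓ) {t : ℤ} (hψ : ψ (MonicCubic.thetaInt hθ) = (t : ZMod ℓ))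
    (x : ι → ℤ × ℤ × ℤ) (hx : ∀ i, ¬ (ℓ : ℤ) ∣ evalInt t (x i)) {T : Finset ι}
    (hsq : IsSquare (∏ i ∈ T, lin hθ (x i).1 (x i).2.1 (x i).2.2)) :
    Even (T.filter (fun i => eulerBit ℓ (evalInt t (x i)) = true)).card := by
  have h := even_card_of_isSquare_legendre (p := ℓ) ψ (fun i => lin hθ (x i).1 (x i).2.1 (x i).2.2)
    (fun i => evalInt t (x i)) (fun i => ringHom_lin_eq hθ ψ hψ (x i))
    (fun i => intCast_zmod_ne_zero (hx i)) hsq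
  convert h using 2
  exact Finset.filter_congr (fun i _ => eulerBit_iff_legendreSym hℓ (intCast_zmod_ne_zero (hx i)))

/-! ## Kernel sanity checks on census data (`K = ℚ(α)`, `α³ + 4α − 1 = 0`, field `M283`; curve `4528a1`) -/

/-- `D = F′(θ) = 23 − 5α + 7α² ∈ (283, α − 248)` and `∈ (2, α² + α + 1)`; `7 + α + α² ∉ (19, α² + 3α + 13)`
by the inverse triple `(0, −8, 0)`; `−4 − α²` is a unit with inverse `−α`; `(2/3) = −1` by Euler. [folklore] -/
example : memCode (283, -248, 1, 0) (23, -5, 7) = true ∧ memCode (2, 1, 1, 1) (23, -5, 7) = true ∧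
    memCode (2, -1, 1, 0) (23, -5, 7) = false ∧ invCert 0 4 (-1) (19, 13, 3, 1) (7, 1, 1) (0, -8, 0) = true ∧
    unitCert 0 4 (-1) (-4, 0, -1) (0, -1, 0) = true ∧ prodPowCert 0 4 (-1) (10, 0, 1) (36, 1, -6) 19 2 = true ∧
    eulerBit 3 2 = true ∧ eulerBit 31 9 = false := by
  decide +kernel

end Summit.BirchSwinnertonDyer.BirchSwinnertonDyer.Rank2Observatory.TwoDescCl

end
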